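import Summits.AnomalousDissipation.AnomalousDissipation.Theorems.CubicParityLoud.Negative.MeanFlow
import Summits.AnomalousDissipation.AnomalousDissipation.Theorems.MomentParityQuarticGateRows
import Summits.AnomalousDissipation.AnomalousDissipation.Theorems.MomentParityQuarticGateCoords
import Summits.AnomalousDissipation.AnomalousDissipation.Theorems.MomentParityCubicParityLoudFarkasCore

/-!
# Stub `stub_farkas` of the line `farkas-split-menu` (crux `MomentParity.CubicParityLoud`,
stmt-AnomalousDissipation-11465): no weak certificate ⇒ a finitely atomic witness

S1 of the lead skeleton `Cruxes/CubicParityLoud/Lines/farkas-split-menu.lean`, in the clause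
vocabulary of `Theorems/CubicParityLoud/Negative/Clauses.lean` (`IsLevel`, `IsBandTest`, `polyGrad`,
`IsWitness`). At fixed `(f, ν, N, E, ε)`: if there is NO weak certificate — no test `(g, P)` with
level-`N` band test fields and `deg P ≤ 2` and multipliers `λ_b, λ_c ≥ 0`, non-trivial in the sense
`λ_b ≠ 0 ∨ λ_c ≠ 0 ∨` the row `u ↦ ⟨F_ν(u), ∇p(u)⟩` is not identically zero on level-`N` fields, with
`⟨F_ν(u), ∇p(u)⟩ + λ_b (E − ‖u‖²) + λ_c (ν‖∇u‖² − ε) ≤ 0` at every level-`N` field — then there is a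
law `μ` on `H` with `IsWitness f ν N E ε μ`, in fact a finite convex combination of Dirac masses at
level-`N` fields.

Proof. (a) An orthonormal band basis `b` of `V_N` (`exists_bandBasis`) and a linear basis `p a` of
the tests of total degree `≤ 2` in `n = dim V_N` variables (`MvPolynomial.restrictTotalDegree`,
`Module.finBasis`); every test `(g, P)` with band test fields and `deg P ≤ 2` has the differential
field of `(b, P ∘ G)` (`polyGrad_transport`), `deg (P ∘ G) ≤ 2` (`totalDegree_bind₁_linear_le`), and
rows are linear in the polynomial (`nsGeneratorPairing_polyGrad_sum_smul`), so every row is a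
combination of the finitely many rows `r(u)_a = ⟨F_ν(u), ∇p_a(u)⟩`. (b) The torus-free core
`farkasCore` (`…FarkasCore.lean`: Hahn–Banach on finite sets + finite-intersection property on the
unit sphere of a finite-dimensional dual) applied to the states `{u // IsLevel N u}`, the rows `r`,
and the budgets `‖u‖²`, `ν‖∇u‖²`: its certificate alternative is excluded by the hypothesis (the test
`(b, Σ_a θ_a p_a)`), so it returns weights `wᵢ ≥ 0`, `Σ wᵢ = 1`, and level-`N` fields `zᵢ` with
`Σ wᵢ r(zᵢ) = 0`, `Σ wᵢ ‖zᵢ‖² ≤ E`, `ε ≤ ν Σ wᵢ ‖∇zᵢ‖²`. (c) `μ := Σᵢ wᵢ δ_{zᵢ}` is a witness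
(finite-sum-of-Diracs bookkeeping, § Atoms).
-/

noncomputable section

-- `Summit.<Summit>.<Problem>` is the tree's mandated summit-side namespace (CONVENTIONS §2); for this
-- single-conjunct summit the two coincide, so the duplicate is deliberate.
set_option linter.dupNamespace false

namespace Summit.AnomalousDissipation.AnomalousDissipation.Theorems.MomentParityCubicParityLoud

open MeasureTheory Filter UnitAddTorus
open scoped InnerProductSpace RealInnerProductSpace ENNReal
open Literature.Analysis.FunctionSpaces Literature.Analysis.FluidPDE
open Summit.AnomalousDissipation.AnomalousDissipation.Theses.MomentParity
open Summit.AnomalousDissipation.AnomalousDissipation.Theorems.CubicParityLoud.Negative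

/-! ## Weighted finite sums of Dirac masses on `H` -/

section Atoms

variable {κ : Type*} [Fintype κ] (w : κ → ℝ) (U : κ → H3)

/-- Every real observable is integrable against a weighted finite sum of Dirac masses on `H`.
[folklore] -/
theorem integrable_sum_dirac (F : H3 → ℝ) :
    Integrable F (∑ i, ENNReal.ofReal (w i) • Measure.dirac (U i)) :=
  integrable_finsetSum_measure.2 fun i _ =>
    (Torus.integrable_dirac (U i) F).smul_measure ENNReal.ofReal_ne_top

/-- Integrals against a weighted finite sum of Dirac masses with non-negative weights:
`∫ F d(Σ wᵢ δ_{Uᵢ}) = Σ wᵢ F(Uᵢ)`. [folklore] -/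
theorem integral_sum_dirac (hw : ∀ i, 0 ≤ w i) (F : H3 → ℝ) :
    ∫ u, F u ∂(∑ i, ENNReal.ofReal (w i) • Measure.dirac (U i)) = ∑ i, w i * F (U i) := by
  haveI : MeasurableSingletonClass H3 := OpensMeasurableSpace.toMeasurableSingletonClass
  rw [integral_finsetSum_measure fun i _ =>
    (Torus.integrable_dirac (U i) F).smul_measure ENNReal.ofReal_ne_top]
  refine Finset.sum_congr rfl fun i _ => ?_
  rw [integral_smul_measure, integral_dirac, ENNReal.toReal_ofReal (hw i), smul_eq_mul]

/-- Lower integrals against a weighted finite sum of Dirac masses: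
`∫⁻ G d(Σ wᵢ δ_{Uᵢ}) = Σ wᵢ G(Uᵢ)`. [folklore] -/
theorem lintegral_sum_dirac (G : H3 → ℝ≥0∞) :
    ∫⁻ u, G u ∂(∑ i, ENNReal.ofReal (w i) • Measure.dirac (U i)) =
      ∑ i, ENNReal.ofReal (w i) * G (U i) := by
  haveI : MeasurableSingletonClass H3 := OpensMeasurableSpace.toMeasurableSingletonClass
  rw [lintegral_finsetSum_measure]
  refine Finset.sum_congr rfl fun i _ => ?_
  rw [lintegral_smul_measure, lintegral_dirac, smul_eq_mul]

/-- A weighted finite sum of Dirac masses with non-negative weights of total mass one is a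
probability measure. [folklore] -/
theorem isProbabilityMeasure_sum_dirac (hw : ∀ i, 0 ≤ w i) (hw1 : ∑ i, w i = 1) :
    IsProbabilityMeasure (∑ i, ENNReal.ofReal (w i) • Measure.dirac (U i)) := by
  refine ⟨?_⟩
  rw [Measure.finsetSum_apply]
  simp_rw [Measure.smul_apply, measure_univ, smul_eq_mul, mul_one]
  rw [← ENNReal.ofReal_sum_of_nonneg fun i _ => hw i, hw1, ENNReal.ofReal_one]

/-- Almost-everywhere statements for a weighted finite sum of Dirac masses follow from the
statement at each atom. [folklore] -/
theorem ae_sum_dirac {q : H3 → Prop} (h : ∀ i, q (U i)) :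
    ∀ᵐ u ∂(∑ i, ENNReal.ofReal (w i) • Measure.dirac (U i)), q u := by
  haveI : MeasurableSingletonClass H3 := OpensMeasurableSpace.toMeasurableSingletonClass
  rw [ae_iff, Measure.finsetSum_apply]
  refine Finset.sum_eq_zero fun i _ => ?_
  rw [Measure.smul_apply, Measure.dirac_apply,
    Set.indicator_of_notMem (show U i ∉ {a | ¬q a} from fun hi => hi (h i)), smul_zero]

end Atoms

/-! ## The stub -/

/-- **S1 — `stub_farkas`: no weak certificate ⇒ a (finitely atomic) witness.** At fixed
`(f, ν, N, E, ε)`: if there is no test `(g, P)` with level-`N` band test fields, `deg P ≤ 2`, and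
multipliers `λ_b, λ_c ≥ 0`, non-trivial (`λ_b ≠ 0 ∨ λ_c ≠ 0 ∨` the row `u ↦ ⟨F_ν(u), ∇p(u)⟩` is not
identically zero on level-`N` fields), with `⟨F_ν(u), ∇p(u)⟩ + λ_b (E − ‖u‖²) + λ_c (ν‖∇u‖² − ε) ≤ 0`
at every level-`N` field, then some law on `H` satisfies all witness clauses of the crux at
`(f, ν, N, E, ε)`. Proof: the torus-free conic duality `farkasCore` applied to level-`N` fields, the
rows of a linear basis of the degree-`≤ 2` tests over an orthonormal band basis of `V_N`, and the two
budgets; the witness is a finite convex combination of Dirac masses. [folklore] -/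
theorem stub_farkas :
    ∀ f : T3 → R3, Torus.IsSmooth f → ∀ (ν : ℝ) (N : ℕ) (E ε : ℝ),
      (¬ ∃ (m : ℕ) (g : Fin m → T3 → R3) (P : MvPolynomial (Fin m) ℝ) (lb lc : ℝ),
          (∀ i, IsBandTest N (g i)) ∧ P.totalDegree ≤ 2 ∧ 0 ≤ lb ∧ 0 ≤ lc ∧
          (lb ≠ 0 ∨ lc ≠ 0 ∨ ∃ u : H3, IsLevel N u ∧
              Torus.nsGeneratorPairing ν f u (polyGrad g P u) ≠ 0) ∧
          ∀ u : H3, IsLevel N u →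
            Torus.nsGeneratorPairing ν f u (polyGrad g P u) + lb * (E - ‖u‖ ^ 2) +
              lc * (ν * (Torus.eGradNormSq ((u : L2T3) : T3 → R3)).toReal - ε) ≤ 0) →
      ∃ μ : Measure H3, IsWitness f ν N E ε μ := by
  intro f hfs ν N E ε hno
  classical
  -- (a) an orthonormal band basis of `V_N`; a linear basis `p` of the tests of degree `≤ 2`
  obtain ⟨n, b, hb, hbo, hbs⟩ := MomentParityQuarticGate.exists_bandBasis N
  set V : Submodule ℝ (MvPolynomial (Fin n) ℝ) := MvPolynomial.restrictTotalDegree (Fin n) ℝ 2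
    with hV
  set p : Fin (Module.finrank ℝ V) → MvPolynomial (Fin n) ℝ := fun a =>
    ((Module.finBasis ℝ V a : V) : MvPolynomial (Fin n) ℝ) with hp
  have hsm : ∀ j, Torus.IsSmooth (b j) := fun j => (hb j).1
  -- rows are linear in the test polynomial
  have hlin : ∀ (u : H3) (c : Fin (Module.finrank ℝ V) → ℝ),
      Torus.nsGeneratorPairing ν f u (polyGrad b (∑ a, c a • p a) u) =
        ∑ a, c a * Torus.nsGeneratorPairing ν f u (polyGrad b (p a) u) := fun u c =>
    MomentParityQuarticGate.nsGeneratorPairing_polyGrad_sum_smul ν hfs hsm Finset.univ c p u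
  -- every test of degree `≤ 2` is a combination of the `p a`, and conversely
  have hspan : ∀ Q : MvPolynomial (Fin n) ℝ, Q.totalDegree ≤ 2 →
      ∃ c : Fin (Module.finrank ℝ V) → ℝ, Q = ∑ a, c a • p a := by
    intro Q hQ
    have hQV : Q ∈ V := (MvPolynomial.mem_restrictTotalDegree _ _ _).2 hQ
    refine ⟨(Module.finBasis ℝ V).repr ⟨Q, hQV⟩, ?_⟩
    have h := congrArg Subtype.val ((Module.finBasis ℝ V).sum_repr ⟨Q, hQV⟩)
    rw [Submodule.coe_sum] at h
    simp_rw [Submodule.coe_smul] at h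
    exact h.symm
  have hdeg : ∀ c : Fin (Module.finrank ℝ V) → ℝ, (∑ a, c a • p a).totalDegree ≤ 2 := by
    intro c
    have hmem : ∑ a, c a • p a ∈ V :=
      Submodule.sum_mem _ fun a _ => Submodule.smul_mem _ _ (Module.finBasis ℝ V a).2
    exact (MvPolynomial.mem_restrictTotalDegree _ _ _).1 hmem
  -- (b) the data of the core: states = level-`N` fields, rows of the `p a`, the two budgets
  set r : {u : H3 // IsLevel N u} → Fin (Module.finrank ℝ V) → ℝ := fun u a =>
    Torus.nsGeneratorPairing ν f u.1 (polyGrad b (p a) u.1) with hr_def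
  set e : {u : H3 // IsLevel N u} → ℝ := fun u => ‖u.1‖ ^ 2 with he_def
  set d : {u : H3 // IsLevel N u} → ℝ := fun u =>
    ν * (Torus.eGradNormSq ((u.1 : L2T3) : T3 → R3)).toReal with hd_def
  have hno' : ¬ ∃ (θ : Fin (Module.finrank ℝ V) → ℝ) (lb lc : ℝ), 0 ≤ lb ∧ 0 ≤ lc ∧
      (lb ≠ 0 ∨ lc ≠ 0 ∨ ∃ u, ∑ a, θ a * r u a ≠ 0) ∧
      ∀ u, ∑ a, θ a * r u a + lb * (E - e u) + lc * (d u - ε) ≤ 0 := by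
    rintro ⟨θ, lb, lc, hlb, hlc, hnt, hcert⟩
    refine hno ⟨n, b, ∑ a, θ a • p a, lb, lc, hb, hdeg θ, hlb, hlc, ?_, fun u hu => ?_⟩
    · rcases hnt with h | h | ⟨u, hu⟩
      · exact Or.inl h
      · exact Or.inr (Or.inl h)
      · refine Or.inr (Or.inr ⟨u.1, u.2, ?_⟩)
        rw [hlin]
        exact hu
    · have h := hcert ⟨u, hu⟩
      rw [hlin]
      exact h
  -- (c) the witness: a finite convex combination of Dirac masses at level-`N` fields
  obtain ⟨κ, _, w, z, hw0, hw1, hrow, hE, hε⟩ := farkasCore r e d E ε hno'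
  refine ⟨∑ i, ENNReal.ofReal (w i) • Measure.dirac (z i).1, ?_⟩
  refine ⟨isProbabilityMeasure_sum_dirac w _ hw0 hw1, ae_sum_dirac w _ fun i => (z i).2,
    integrable_sum_dirac w _ _, ?_, ?_, ?_⟩
  · -- rows of all tests of degree `≤ 2` with band test fields
    intro m g P hg hP
    refine ⟨integrable_sum_dirac w _ _, ?_⟩
    -- transport the test to the basis `b`
    set G : Fin m → Fin n → ℝ := fun j l => ∫ y, ⟪g j y, b l y⟫_ℝ with hG
    have hgb : ∀ j x, g j x = ∑ l, G j l • b l x := fun j x =>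
      MomentParityQuarticGate.band_eq_sum_smul hbs (hg j) x
    have hpair : ∀ (u : H3) (j : Fin m),
        Torus.pairing u.1 (g j) = ∑ l, G j l * Torus.pairing u.1 (b l) := fun u j =>
      MomentParityQuarticGate.pairing_band_eq_sum hb hbs (hg j) u
    set P' : MvPolynomial (Fin n) ℝ :=
      MvPolynomial.bind₁ (fun j => ∑ l, MvPolynomial.C (G j l) * MvPolynomial.X l) P with hP'
    have htr : ∀ u : H3, polyGrad g P u = polyGrad b P' u := fun u =>
      funext fun x => MomentParityQuarticGate.polyGrad_transport G hgb hpair P u x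
    have hP'deg : P'.totalDegree ≤ 2 :=
      (MomentParityQuarticGate.totalDegree_bind₁_linear_le G P).trans (by omega)
    obtain ⟨c, hc⟩ := hspan P' hP'deg
    have hF : (fun u : H3 => Torus.nsGeneratorPairing ν f u (polyGrad g P u)) = fun u =>
        ∑ a, c a * Torus.nsGeneratorPairing ν f u (polyGrad b (p a) u) := by
      funext u
      rw [htr, hc, hlin]
    rw [hF, integral_sum_dirac w _ hw0]
    calc ∑ i, w i * ∑ a, c a * Torus.nsGeneratorPairing ν f (z i).1 (polyGrad b (p a) (z i).1)
        = ∑ a, c a * ∑ i, w i * r (z i) a := by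
          simp_rw [Finset.mul_sum]
          rw [Finset.sum_comm]
          refine Finset.sum_congr rfl fun a _ => Finset.sum_congr rfl fun i _ => ?_
          simp only [hr_def]
          ring
      _ = 0 := Finset.sum_eq_zero fun a _ => by rw [hrow a, mul_zero]
  · -- energy
    show ∫ u, ‖u‖ ^ 2 ∂_ ≤ E
    rw [integral_sum_dirac w _ hw0]
    exact hE
  · -- dissipation
    unfold Torus.ensembleDissipation Torus.ensembleEnstrophy
    rw [lintegral_sum_dirac]
    have hfin : ∀ i, Torus.eGradNormSq (((z i).1 : L2T3) : T3 → R3) ≠ ⊤ := fun i =>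
      (eGradNormSq_lt_top_of_isLevel (z i).2).ne
    rw [ENNReal.toReal_sum fun i _ => ENNReal.mul_ne_top ENNReal.ofReal_ne_top (hfin i)]
    simp_rw [ENNReal.toReal_mul, ENNReal.toReal_ofReal (hw0 _)]
    rw [Finset.mul_sum]
    calc ε ≤ ∑ i, w i * d (z i) := hε
      _ = ∑ i, ν * (w i * (Torus.eGradNormSq (((z i).1 : L2T3) : T3 → R3)).toReal) :=
          Finset.sum_congr rfl fun i _ => by
            simp only [hd_def]
            ring

end Summit.AnomalousDissipation.AnomalousDissipation.Theorems.MomentParityCubicParityLoud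

end
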